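import Literature.NumberTheory.Sieve.HeathBrownCubicTypeII
import Mathlib.Analysis.SpecialFunctions.Pow.Asymptotics
import HarnessLib

/-!
# Heath-Brown's Lemma 3.10 from the bound of p. 83: the choice `Y = Q₁^{1/80}` ((13.7))

Pure reduction layer in the decomposition of **Heath-Brown's Type II estimate, Lemma 3.10**
(`HeathBrown2001_lemma_3_10` of `HeathBrownCubicTypeII`, a named fact of the decomposition of
parity.S18 along D. R. Heath-Brown, *Primes represented by `x³ + 2y³`*, Acta Math. 186 (2001), 1–84).
Lemma 3.10 is proved in §§11–13 of the paper (pp. 66–83).  The argument introduces a free parameter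
`Y = Y(X)` with `1 ≪ Y ≪ X^{τ/3}` ((11.8)), and everything up to the last half page establishes, for the
sum `S_V = ∑_R c_R ∑_{RS ∈ 𝒜^(K), V < N(S) ≤ 2V} f_S` of (11.1) (the left side of Lemma 3.10), the bound

  `S_V ≪ X² (Y^{-1/2} + Y^{30} X^{-τ/4} + Y⁸ Q₁^{-1/8} + Y⁸ Q₁² exp{−c√(log L)}) (log X)^c`   (p. 83)

(Lemma 12.2 combined with the large-sieve estimate of §13 for `S₈` and the choice `Q₀ = Q₁^{1/2}`;
Harman, *Prime-Detecting Sieves*, §13.8, p. 284, same display).  The paper then concludes: "We now choose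
`Y = Q₁^{1/80}` (13.7), which is in accordance with the condition (11.8), since `Q₁ ≤ exp{(log X)^{1/3}}`.
By virtue of this bound for `Q₁` we finally see that our estimate reduces to `S_V ≪ X²Q₁^{-1/160}(log X)^c`,
as required for Lemma 3.10."

This pure-proof file (no definitions, no named facts) PROVES the last step: Lemma 3.10 follows from the
displayed bound of p. 83, the latter written out as the HYPOTHESIS `h` of
`HeathBrown2001_lemma_3_10_of_SV_bound` in the setting and with the quantifier structure of
`HeathBrown2001_lemma_3_10` (uniformly in `Y` with `1 ≤ Y ≤ X^{τ/3}`; the constant in the exponential is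
existential).  Under D-0026 the bound of p. 83 is not vendored as a named fact here (it is a slice of the
proof of Lemma 3.10, resting on Lemmas 11.1, 11.2, 12.1, 12.2, 13.1 and §4 of the paper); the hypothesis is
to be discharged by the later layers of the decomposition, at which point this theorem closes Lemma 3.10.

The four comparisons behind "(13.7) is in accordance with (11.8)" and "our estimate reduces to" are, with
`L = log X`, `τ = (log L)^{−ϖ}`, `1 ≤ Q₁ ≤ exp(L^{1/3})`, `Y = Q₁^{1/80}` and `X` large:
`Y ≤ exp(L^{1/3}/80) ≤ X^{τ/3}`; `Y^{-1/2} = Q₁^{-1/160}`; `Y^{30}X^{-τ/4} = Q₁^{3/8}X^{-τ/4} ≤ Q₁^{-1/160}`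
(as `Q₁^{61/160} ≤ exp(61 L^{1/3}/160) ≤ X^{τ/4}`); `Y⁸Q₁^{-1/8} = Q₁^{-1/40} ≤ Q₁^{-1/160}`;
`Y⁸Q₁² exp(−c√(log L')) = Q₁^{21/10} exp(−c√(τL/2)) ≤ Q₁^{-1/160}` (`L' = X^{τ/2}`, as
`(337/160)L^{1/3} ≤ c√(τL/2)`) — each an instance of `(log L)^ϖ = o(L^a)` (`eventually_loglog_rpow_le`).

## References

* D. R. Heath-Brown, *Primes represented by `x³ + 2y³`*, Acta Math. 186 (2001), 1–84: §11 (11.1), (11.8);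
  §13 p. 83 and (13.7). [cite: HeathBrownActa2001, §13 p. 83, (13.7)]
* G. Harman, *Prime-Detecting Sieves*, LMS Monographs 33, Princeton (2007), §13.8 pp. 278–284
  ((13.8.6), (13.8.8), p. 284). [cite: Harman2007, §13.8]

## Mathlib / tree search

Mathlib: `isLittleO_log_rpow_rpow_atTop` (`(log x)^r = o(x^s)`), `Real.rpow_def_of_pos`, `Real.rpow_mul`,
`Real.le_sqrt`, `Real.exp_le_exp`. Tree: `HeathBrownCubicTypeII` (`HeathBrown2001_lemma_3_10`, `Hyp314`,
`bilin`, `fWeight`, `CoreAdmissible`, `CSupport`, `hbL`), `HeathBrownCubicSieveDecomposition` (`hbTau`).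
-/

noncomputable section

open Polynomial NumberField Finset Filter Topology Asymptotics

namespace Literature.NumberTheory.Sieve.CubicSieve

open LFunctions.CubeRootTwoField CubicPrimes

/-! ### The parameters for large `X` -/

/-- `(log log X)^ϖ = o((log X)^a)` for `a > 0`, in the form: eventually `B (log log X)^ϖ ≤ (log X)^a`.
[folklore] -/
theorem eventually_loglog_rpow_le (ϖ B : ℝ) {a : ℝ} (ha : 0 < a) :
    ∀ᶠ X : ℝ in atTop, B * Real.log (Real.log X) ^ ϖ ≤ Real.log X ^ a := by
  rcases le_or_gt B 0 with hB | hB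
  · filter_upwards [Real.tendsto_log_atTop.eventually (eventually_ge_atTop (1 : ℝ))] with X hL1
    have h1 : 0 ≤ Real.log (Real.log X) ^ ϖ := Real.rpow_nonneg (Real.log_nonneg hL1) _
    have h2 : 0 ≤ Real.log X ^ a := Real.rpow_nonneg (by linarith) _
    nlinarith
  · have hlo : ∀ᶠ L : ℝ in atTop, ‖Real.log L ^ ϖ‖ ≤ B⁻¹ * ‖L ^ a‖ :=
      (isLittleO_log_rpow_rpow_atTop ϖ ha).def (inv_pos.2 hB)
    filter_upwards [Real.tendsto_log_atTop.eventually hlo,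
      Real.tendsto_log_atTop.eventually (eventually_ge_atTop (1 : ℝ))] with X hX hL1
    have h1 : 0 ≤ Real.log (Real.log X) ^ ϖ := Real.rpow_nonneg (Real.log_nonneg hL1) _
    have h2 : 0 ≤ Real.log X ^ a := Real.rpow_nonneg (by linarith) _
    rw [Real.norm_of_nonneg h1, Real.norm_of_nonneg h2] at hX
    calc B * Real.log (Real.log X) ^ ϖ ≤ B * (B⁻¹ * Real.log X ^ a) :=
          mul_le_mul_of_nonneg_left hX hB.le
      _ = Real.log X ^ a := by field_simp

/-- The asymptotic inequalities behind (13.7): eventually in `X`, with `L = log X` and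
`τ = (log L)^{−ϖ}`: `X ≥ 2`, `L ≥ 1`, `τ > 0`, `(1/80)L^{1/3} ≤ τL/3`, `(61/160)L^{1/3} ≤ τL/4` and
`(337/160)L^{1/3} ≤ c₂√(τL/2)` (each because `(log L)^ϖ = o(L^a)` for `a > 0`). [folklore] -/
theorem eventually_reduction_params (ϖ : ℝ) {c₂ : ℝ} (hc₂ : 0 < c₂) :
    ∀ᶠ X : ℝ in atTop,
      2 ≤ X ∧ 1 ≤ Real.log X ∧ 0 < hbTau ϖ X ∧
        (1 / 80) * Real.log X ^ (1 / 3 : ℝ) ≤ hbTau ϖ X * Real.log X / 3 ∧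
        (61 / 160) * Real.log X ^ (1 / 3 : ℝ) ≤ hbTau ϖ X * Real.log X / 4 ∧
        (337 / 160) * Real.log X ^ (1 / 3 : ℝ) ≤
          c₂ * Real.sqrt (hbTau ϖ X * Real.log X / 2) := by
  filter_upwards [eventually_ge_atTop (2 : ℝ),
    Real.tendsto_log_atTop.eventually (eventually_ge_atTop (1 : ℝ)),
    (Real.tendsto_log_atTop.comp Real.tendsto_log_atTop).eventually (eventually_ge_atTop (1 : ℝ)),
    eventually_loglog_rpow_le ϖ (3 / 80) (by norm_num : (0 : ℝ) < 2 / 3),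
    eventually_loglog_rpow_le ϖ (61 / 40) (by norm_num : (0 : ℝ) < 2 / 3),
    eventually_loglog_rpow_le ϖ (2 * (337 / 160) ^ 2 / c₂ ^ 2) (by norm_num : (0 : ℝ) < 1 / 3)]
    with X hX2 hL1 hM1 hA hB hC
  set L := Real.log X with hL
  set M := Real.log L with hMdef
  have hM1' : 1 ≤ M := hM1
  have hLpos : 0 < L := by linarith
  have hMpos : 0 < M := by linarith
  have hτ : hbTau ϖ X = (M ^ ϖ)⁻¹ := by
    rw [hbTau, ← hL, ← hMdef, Real.rpow_neg hMpos.le]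
  have hMϖ : 0 < M ^ ϖ := Real.rpow_pos_of_pos hMpos _
  have hτpos : 0 < hbTau ϖ X := by rw [hτ]; positivity
  have hL13 : 0 < L ^ (1 / 3 : ℝ) := Real.rpow_pos_of_pos hLpos _
  have hL23 : L ^ (2 / 3 : ℝ) * L ^ (1 / 3 : ℝ) = L := by
    rw [← Real.rpow_add hLpos]; norm_num
  have hL13sq : L ^ (1 / 3 : ℝ) * L ^ (1 / 3 : ℝ) = L ^ (2 / 3 : ℝ) := by
    rw [← Real.rpow_add hLpos]; norm_num
  refine ⟨hX2, hL1, hτpos, ?_, ?_, ?_⟩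
  · -- `(1/80) L^{1/3} ≤ τ L / 3` iff `(3/80) M^ϖ L^{1/3} ≤ L`
    rw [hτ, le_div_iff₀ (by norm_num : (0 : ℝ) < 3), inv_mul_eq_div, le_div_iff₀ hMϖ]
    calc 1 / 80 * L ^ (1 / 3 : ℝ) * 3 * M ^ ϖ = (3 / 80 * M ^ ϖ) * L ^ (1 / 3 : ℝ) := by ring
      _ ≤ L ^ (2 / 3 : ℝ) * L ^ (1 / 3 : ℝ) := mul_le_mul_of_nonneg_right hA hL13.le
      _ = L := hL23
  · rw [hτ, le_div_iff₀ (by norm_num : (0 : ℝ) < 4), inv_mul_eq_div, le_div_iff₀ hMϖ]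
    calc 61 / 160 * L ^ (1 / 3 : ℝ) * 4 * M ^ ϖ = (61 / 40 * M ^ ϖ) * L ^ (1 / 3 : ℝ) := by ring
      _ ≤ L ^ (2 / 3 : ℝ) * L ^ (1 / 3 : ℝ) := mul_le_mul_of_nonneg_right hB hL13.le
      _ = L := hL23
  · -- square both sides
    have hlhs : 0 ≤ 337 / 160 * L ^ (1 / 3 : ℝ) := by positivity
    have harg : 0 ≤ hbTau ϖ X * L / 2 := by positivity
    have hMϖne : M ^ ϖ ≠ 0 := hMϖ.ne'
    rw [show c₂ * Real.sqrt (hbTau ϖ X * L / 2) = Real.sqrt (c₂ ^ 2 * (hbTau ϖ X * L / 2)) by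
      rw [Real.sqrt_mul' _ harg, Real.sqrt_sq hc₂.le]]
    refine (Real.le_sqrt hlhs (by positivity)).mpr ?_
    have key : 2 * (337 / 160) ^ 2 * M ^ ϖ * L ^ (2 / 3 : ℝ) ≤ c₂ ^ 2 * L := by
      have h1 : 2 * (337 / 160 : ℝ) ^ 2 * M ^ ϖ =
          c₂ ^ 2 * (2 * (337 / 160) ^ 2 / c₂ ^ 2 * M ^ ϖ) := by
        field_simp
      calc 2 * (337 / 160) ^ 2 * M ^ ϖ * L ^ (2 / 3 : ℝ)
          = c₂ ^ 2 * ((2 * (337 / 160) ^ 2 / c₂ ^ 2 * M ^ ϖ) * L ^ (2 / 3 : ℝ)) := by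
            rw [h1]; ring
        _ ≤ c₂ ^ 2 * (L ^ (1 / 3 : ℝ) * L ^ (2 / 3 : ℝ)) := by
            refine mul_le_mul_of_nonneg_left ?_ (by positivity)
            exact mul_le_mul_of_nonneg_right hC (Real.rpow_nonneg hLpos.le _)
        _ = c₂ ^ 2 * L := by rw [mul_comm (L ^ (1 / 3 : ℝ)), hL23]
    have hsq : (337 / 160 * L ^ (1 / 3 : ℝ)) ^ 2 = (337 / 160) ^ 2 * L ^ (2 / 3 : ℝ) := by
      rw [mul_pow, sq (L ^ (1 / 3 : ℝ)), hL13sq]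
    rw [hsq, hτ]
    have e : c₂ ^ 2 * ((M ^ ϖ)⁻¹ * L / 2) = c₂ ^ 2 * L / (2 * M ^ ϖ) := by
      field_simp
    rw [e, le_div_iff₀ (by positivity)]
    calc (337 / 160 : ℝ) ^ 2 * L ^ (2 / 3 : ℝ) * (2 * M ^ ϖ)
        = 2 * (337 / 160) ^ 2 * M ^ ϖ * L ^ (2 / 3 : ℝ) := by ring
      _ ≤ c₂ ^ 2 * L := key

/-! ### Lemma 3.10 from the bound of p. 83 -/

open scoped Classical in
/-- **Heath-Brown's Lemma 3.10 from the bound of p. 83 by the choice `Y = Q₁^{1/80}` ((13.7))**: "We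
now choose `Y = Q₁^{1/80}`, which is in accordance with the condition (11.8), since
`Q₁ ≤ exp{(log X)^{1/3}}`. By virtue of this bound for `Q₁` we finally see that our estimate reduces to
`S_V ≪ X²Q₁^{-1/160}(log X)^c`, as required for Lemma 3.10." (p. 83).  The hypothesis `h` is the bound
of p. 83 (the display preceding (13.7); Harman 2007, p. 284):
"`S_V ≪ X² (Y^{-1/2} + Y^{30}X^{-τ/4} + Y⁸Q₁^{-1/8} + Y⁸Q₁² exp{−c√(log L)}) (log X)^c`" for the sum
`S_V = ∑_R c_R ∑_{RS ∈ 𝒜^(K), V < N(S) ≤ 2V} f_S` of (11.1) (the left side of Lemma 3.10), `L = X^{τ/2}`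
((3.13)), in the setting of Lemma 3.10 — (3.14) up to `Q₁ ≤ exp{(log X)^{1/3}}` subject to the conditions
of Lemma 3.8, `X^{1+τ} ≪ V ≪ X^{3/2−τ}` ((11.1)) — uniformly in the parameter `Y` of (11.8),
`1 ≤ Y ≤ X^{τ/3}`, written with the quantifier structure of `HeathBrown2001_lemma_3_10` (the constant `c₂`
of the exponential existential, together with `C` and `X₀`).  With `Y = Q₁^{1/80}` each of the four terms is
at most `Q₁^{-1/160}` for `X` large (module docstring), so Lemma 3.10 holds with the same exponent `c`, the
same cube-condition constants `c₃, c₄`, and the constant `4 max(C, 0)`.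
[cite: HeathBrownActa2001, §13 p. 83, (13.7)] [cite: Harman2007, §13.8 p. 284] -/
theorem HeathBrown2001_lemma_3_10_of_SV_bound
    (h :
      ∀ ϖ : ℝ, 0 < ϖ → ϖ < 1 / 5 →
        ∃ c c₃ c₄ : ℝ, 0 < c₃ ∧ 0 < c₄ ∧ ∀ C₁ c₁ c₅ c₆ : ℝ, 0 < c₁ → 0 < c₅ → 0 < c₆ →
          ∃ C c₂ X₀ : ℝ, 0 < c₂ ∧ ∀ X η Q₁ Y : ℝ, X₀ ≤ X → Real.exp (-Real.log X ^ (1 / 3 : ℝ)) ≤ η →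
            η ≤ 1 → 1 ≤ Q₁ → Q₁ ≤ Real.exp (Real.log X ^ (1 / 3 : ℝ)) → 1 ≤ Y →
              Y ≤ X ^ (hbTau ϖ X / 3) →
              (∀ (k' : ℕ) (m' : Fin k' → ℕ), CoreAdmissible (hbTau ϖ X) m' →
                Hyp314 X (hbTau ϖ X) m' Q₁ C₁ c₁ c₃ c₄) →
                ∀ (k : ℕ) (m : Fin k → ℕ), CoreAdmissible (hbTau ϖ X) m →
                  ∀ cR : Ideal (𝓞 K) → ℝ, CSupport X (hbTau ϖ X) cR →
                    ∀ V : ℝ, c₅ * X ^ (1 + hbTau ϖ X) ≤ V → V ≤ c₆ * X ^ (3 / 2 - hbTau ϖ X) →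
                      |bilin (boxPairs X η) pairIdeal cR
                          (fun S => if V < (Ideal.absNorm S : ℝ) ∧ (Ideal.absNorm S : ℝ) ≤ 2 * V then
                            fWeight X (hbTau ϖ X) m S else 0)| ≤
                        C * X ^ 2 *
                          (Y ^ (-(1 / 2 : ℝ)) + Y ^ 30 * X ^ (-(hbTau ϖ X / 4)) +
                            Y ^ 8 * Q₁ ^ (-(1 / 8 : ℝ)) +
                            Y ^ 8 * Q₁ ^ 2 *
                              Real.exp (-(c₂ * Real.sqrt (Real.log (hbL X (hbTau ϖ X)))))) *
                          Real.log X ^ c) :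
    HeathBrown2001_lemma_3_10 := by
  intro ϖ hϖ0 hϖ5
  obtain ⟨c, c₃, c₄, hc₃, hc₄, H⟩ := h ϖ hϖ0 hϖ5
  refine ⟨c, c₃, c₄, hc₃, hc₄, fun C₁ c₁ c₅ c₆ hc₁ hc₅ hc₆ => ?_⟩
  obtain ⟨C, c₂, X₀, hc₂, HX⟩ := H C₁ c₁ c₅ c₆ hc₁ hc₅ hc₆
  obtain ⟨X₁, hX₁⟩ := Filter.eventually_atTop.mp (eventually_reduction_params ϖ hc₂)
  refine ⟨4 * max C 0, max X₀ X₁,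
    fun X η Q₁ hX hη1 hη2 hQ1 hQ2 hHyp k m hm cR hcR V hV1 hV2 => ?_⟩
  obtain ⟨hX2, hL1, hτpos, hA, hB, hC⟩ := hX₁ X (le_of_max_le_right hX)
  have hXX₀ : X₀ ≤ X := le_of_max_le_left hX
  have hX0 : 0 < X := by linarith
  have hLpos : 0 < Real.log X := by linarith
  have hQpos : 0 < Q₁ := by linarith
  -- the choice `Y = Q₁^{1/80}`
  obtain ⟨Y, hYdef⟩ : ∃ Y : ℝ, Y = Q₁ ^ (1 / 80 : ℝ) := ⟨_, rfl⟩
  have hY1 : 1 ≤ Y := hYdef ▸ Real.one_le_rpow hQ1 (by norm_num)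
  have hYpos : 0 < Y := by linarith
  -- `Q₁^a ≤ exp(a (log X)^{1/3})` for `a ≥ 0`, and `X^s = exp(s log X)`
  have hQpow : ∀ a : ℝ, 0 ≤ a → Q₁ ^ a ≤ Real.exp (a * Real.log X ^ (1 / 3 : ℝ)) := by
    intro a ha
    calc Q₁ ^ a ≤ (Real.exp (Real.log X ^ (1 / 3 : ℝ))) ^ a := Real.rpow_le_rpow hQpos.le hQ2 ha
      _ = Real.exp (a * Real.log X ^ (1 / 3 : ℝ)) := by rw [← Real.exp_mul, mul_comm]
  have hXpow : ∀ s : ℝ, X ^ s = Real.exp (s * Real.log X) := fun s => by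
    rw [Real.rpow_def_of_pos hX0, mul_comm]
  -- (13.7) is in accordance with (11.8): `Y ≤ X^{τ/3}`
  have hYX : Y ≤ X ^ (hbTau ϖ X / 3) := by
    calc Y = Q₁ ^ (1 / 80 : ℝ) := hYdef
      _ ≤ Real.exp ((1 / 80) * Real.log X ^ (1 / 3 : ℝ)) := hQpow _ (by norm_num)
      _ ≤ Real.exp (hbTau ϖ X / 3 * Real.log X) :=
          Real.exp_le_exp.mpr (hA.trans_eq (by ring))
      _ = X ^ (hbTau ϖ X / 3) := (hXpow _).symm
  have hmain := HX X η Q₁ Y hXX₀ hη1 hη2 hQ1 hQ2 hY1 hYX hHyp k m hm cR hcR V hV1 hV2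
  -- the four terms are each `≤ T = Q₁^{-1/160}`
  obtain ⟨T, hT⟩ : ∃ T : ℝ, T = Q₁ ^ (-(1 / 160 : ℝ)) := ⟨_, rfl⟩
  have hTpos : 0 < T := hT ▸ Real.rpow_pos_of_pos hQpos _
  have h1 : Y ^ (-(1 / 2 : ℝ)) = T := by
    rw [hYdef, hT, ← Real.rpow_mul hQpos.le]; norm_num
  have h2 : Y ^ 30 * X ^ (-(hbTau ϖ X / 4)) ≤ T := by
    have e1 : Y ^ 30 = Q₁ ^ (3 / 8 : ℝ) := by
      rw [hYdef, ← Real.rpow_natCast, ← Real.rpow_mul hQpos.le]; norm_num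
    have e2 : Q₁ ^ (3 / 8 : ℝ) = T * Q₁ ^ (61 / 160 : ℝ) := by
      rw [hT, ← Real.rpow_add hQpos]; norm_num
    have e3 : Q₁ ^ (61 / 160 : ℝ) ≤ X ^ (hbTau ϖ X / 4) := by
      calc Q₁ ^ (61 / 160 : ℝ) ≤ Real.exp ((61 / 160) * Real.log X ^ (1 / 3 : ℝ)) :=
            hQpow _ (by norm_num)
        _ ≤ Real.exp (hbTau ϖ X / 4 * Real.log X) :=
            Real.exp_le_exp.mpr (hB.trans_eq (by ring))
        _ = X ^ (hbTau ϖ X / 4) := (hXpow _).symm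
    have hXτ : 0 < X ^ (hbTau ϖ X / 4) := Real.rpow_pos_of_pos hX0 _
    rw [e1, e2, Real.rpow_neg hX0.le, mul_assoc]
    calc T * (Q₁ ^ (61 / 160 : ℝ) * (X ^ (hbTau ϖ X / 4))⁻¹) ≤ T * 1 := by
          refine mul_le_mul_of_nonneg_left ?_ hTpos.le
          rw [mul_inv_le_iff₀ hXτ, one_mul]; exact e3
      _ = T := mul_one T
  have h3 : Y ^ 8 * Q₁ ^ (-(1 / 8 : ℝ)) ≤ T := by
    have e1 : Y ^ 8 * Q₁ ^ (-(1 / 8 : ℝ)) = Q₁ ^ (-(1 / 40 : ℝ)) := by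
      rw [hYdef, ← Real.rpow_natCast, ← Real.rpow_mul hQpos.le, ← Real.rpow_add hQpos]
      norm_num
    rw [e1, hT]
    exact Real.rpow_le_rpow_of_exponent_le hQ1 (by norm_num)
  have h4 : Y ^ 8 * Q₁ ^ 2 * Real.exp (-(c₂ * Real.sqrt (Real.log (hbL X (hbTau ϖ X))))) ≤ T := by
    have e1 : Y ^ 8 * Q₁ ^ 2 = T * Q₁ ^ (337 / 160 : ℝ) := by
      rw [hYdef, ← Real.rpow_natCast, ← Real.rpow_mul hQpos.le, ← Real.rpow_natCast Q₁ 2,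
        ← Real.rpow_add hQpos, hT, ← Real.rpow_add hQpos]
      norm_num
    have e2 : Real.log (hbL X (hbTau ϖ X)) = hbTau ϖ X * Real.log X / 2 := by
      rw [hbL, Real.log_rpow hX0]; ring
    have e3 : Q₁ ^ (337 / 160 : ℝ) ≤
        Real.exp (c₂ * Real.sqrt (Real.log (hbL X (hbTau ϖ X)))) := by
      calc Q₁ ^ (337 / 160 : ℝ) ≤ Real.exp ((337 / 160) * Real.log X ^ (1 / 3 : ℝ)) :=
            hQpow _ (by norm_num)
        _ ≤ Real.exp (c₂ * Real.sqrt (Real.log (hbL X (hbTau ϖ X)))) := by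
            rw [e2]; exact Real.exp_le_exp.mpr hC
    have hE : 0 < Real.exp (c₂ * Real.sqrt (Real.log (hbL X (hbTau ϖ X)))) := Real.exp_pos _
    rw [e1, Real.exp_neg, mul_assoc]
    calc T * (Q₁ ^ (337 / 160 : ℝ) *
          (Real.exp (c₂ * Real.sqrt (Real.log (hbL X (hbTau ϖ X)))))⁻¹) ≤ T * 1 := by
          refine mul_le_mul_of_nonneg_left ?_ hTpos.le
          rw [mul_inv_le_iff₀ hE, one_mul]; exact e3
      _ = T := mul_one T
  -- assemble
  have hsum : Y ^ (-(1 / 2 : ℝ)) + Y ^ 30 * X ^ (-(hbTau ϖ X / 4)) + Y ^ 8 * Q₁ ^ (-(1 / 8 : ℝ)) +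
      Y ^ 8 * Q₁ ^ 2 * Real.exp (-(c₂ * Real.sqrt (Real.log (hbL X (hbTau ϖ X))))) ≤ 4 * T := by
    rw [h1]; linarith
  have hsum0 : 0 ≤ Y ^ (-(1 / 2 : ℝ)) + Y ^ 30 * X ^ (-(hbTau ϖ X / 4)) +
      Y ^ 8 * Q₁ ^ (-(1 / 8 : ℝ)) +
      Y ^ 8 * Q₁ ^ 2 * Real.exp (-(c₂ * Real.sqrt (Real.log (hbL X (hbTau ϖ X))))) := by
    positivity
  have hLc : 0 ≤ Real.log X ^ c := Real.rpow_nonneg hLpos.le _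
  have hC0 : C ≤ max C 0 := le_max_left _ _
  have hM0 : 0 ≤ max C 0 := le_max_right _ _
  refine hmain.trans ?_
  calc C * X ^ 2 * (Y ^ (-(1 / 2 : ℝ)) + Y ^ 30 * X ^ (-(hbTau ϖ X / 4)) +
          Y ^ 8 * Q₁ ^ (-(1 / 8 : ℝ)) +
          Y ^ 8 * Q₁ ^ 2 * Real.exp (-(c₂ * Real.sqrt (Real.log (hbL X (hbTau ϖ X)))))) *
        Real.log X ^ c
      ≤ max C 0 * X ^ 2 * (Y ^ (-(1 / 2 : ℝ)) + Y ^ 30 * X ^ (-(hbTau ϖ X / 4)) +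
          Y ^ 8 * Q₁ ^ (-(1 / 8 : ℝ)) +
          Y ^ 8 * Q₁ ^ 2 * Real.exp (-(c₂ * Real.sqrt (Real.log (hbL X (hbTau ϖ X)))))) *
        Real.log X ^ c :=
        mul_le_mul_of_nonneg_right (mul_le_mul_of_nonneg_right
          (mul_le_mul_of_nonneg_right hC0 (by positivity)) hsum0) hLc
    _ ≤ max C 0 * X ^ 2 * (4 * T) * Real.log X ^ c :=
        mul_le_mul_of_nonneg_right (mul_le_mul_of_nonneg_left hsum (by positivity)) hLc
    _ = 4 * max C 0 * X ^ 2 * Q₁ ^ (-(1 / 160 : ℝ)) * Real.log X ^ c := by rw [hT]; ring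

end Literature.NumberTheory.Sieve.CubicSieve

end
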